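import Mathlib.Analysis.InnerProductSpace.PiL2
import Mathlib.MeasureTheory.Measure.Haar.InnerProductSpace
import Mathlib.MeasureTheory.Measure.Lebesgue.EqHaar
import Mathlib.Analysis.SpecialFunctions.Trigonometric.Inverse
import Mathlib.Geometry.Euclidean.Angle.Unoriented.Basic
import Mathlib.LinearAlgebra.LinearIndependent.Lemmas
import Literature.Geometry.DiscreteGeometry.SolidAngleFraction
import HarnessLib

/-!
# The volume of a spherical wedge is proportional to its dihedral angle — proved
# (the area of a lune; `dihedralFraction = dih / 2π` in the language of `SolidAngleFraction.lean`)

Topic `Literature/Geometry/DiscreteGeometry`.  The module docstring of `SolidAngleFraction.lean`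
(normalised solid and dihedral angles as unit-ball volume fractions, Hales 2012 §3.2 / DSP
Definition 2.66, for route `AtomisticToContinuum/…/ReggeStarBounds`) lists as "wanted later,
genuine theorems": rotation invariance, `dihedralFraction = (dihedral angle)/2π`, and Girard's
formula.  This file proves the first two in the following form, in ANY finite-dimensional real
inner product space `E` with its canonical volume (`measureSpaceOfInnerProductSpace`; on
`EuclideanSpace ℝ (Fin 3)` this is `volume`, definitionally):

**Theorem** (`volume_halfspace_inter_halfspace_inter_ball`,
`ballFraction_halfspace_inter_halfspace`, `…_apex`).  For linearly independent `n₁, n₂ ∈ E`, the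
wedge `{⟪n₁, ·⟫ ≥ 0} ∩ {⟪n₂, ·⟫ ≥ 0}` (dihedral angle `π − ∠(n₁, n₂)`) meets the unit ball in the
fraction `(π − ∠(n₁, n₂)) / 2π` of its volume; the same about any apex `v`.  In `ℝ³` this is
the classical "the area of a spherical lune of angle `α` is `2α`" (solid angle `= 3 · vol`, Hales
2012 §3.2), the first step of Girard's theorem and of every area argument on `S²` (it is also the
road to Euler's formula for spherical subdivisions by Gauss–Bonnet, cf. the face theory wanted
by `SphericalCodeVertexStar.lean` and by `CountingSpheres*.lean`).

The proof uses no integration: with `f(θ) = vol (wedge of angle θ ∩ B)`,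
* `f` is ADDITIVE (`wedgeVol_add`): a wedge of angle `s + t ≤ π` splits along the half-plane of
  azimuth `s` into wedges of angles `s` and `t` overlapping in a null plane
  (`wedge_eq_union`, `wedge_inter_wedge_subset`, `volume_wedgeFun_eq_zero`), and the second
  piece is rotated back by the ROTATION INVARIANCE of the volume (`planeRot`, an explicit linear
  isometry equivalence rotating the plane of an orthonormal pair and fixing its orthogonal
  complement; `volume_wedge_inter_ball_add` via `LinearIsometryEquiv.measurePreserving`);
* `f` is MONOTONE (`wedgeVol_monotoneOn`) and `f(π) = vol B / 2` (`wedgeVol_pi`: a closed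
  half-space through the centre halves the ball, `volume_halfspace_inter_ball`, by the symmetry
  `x ↦ −x` and the nullity of hyperplanes `volume_inner_eq_zero`);
* an additive monotone function on `[0, π]` is linear (`eq_div_mul_of_additive_of_monotoneOn`,
  Cauchy's functional equation with monotonicity) — so `f(θ) = (θ/2π) vol B` (`wedgeVol_eq`,
  `volume_wedge_inter_ball`);
* finally two independent normals `n₁, n₂` are put in the normal form `wedge e₀ e₁ 0 θ`,
  `θ = arccos(−⟪e₁, n₂⟫/‖n₂‖) = π − ∠(n₁, n₂)`, of an orthonormal pair `e₀, e₁` (Part D).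

Everything here is a definition (`wedgeFun`, `wedge`, `planeRotLin`, `planeRot`, `wedgeVol`) or
PROVED; no named facts.  Not here (next bricks): the identification of
`apexWedge v (w − v) u` of `SolidAngleFraction.lean` with such an intersection of two half-spaces
(so that `dihedralFraction v w u = dih / 2π` literally), and Girard's formula
`sol = dih₁ + dih₂ + dih₃ − π`.

## References

* T. C. Hales, *Dense Sphere Packings: a blueprint for formal proofs*, CUP 2012, §3.2 (solid
  angle as `3 · vol`), Definition 2.66 (dihedral angle). [`HalesDSP2012`]
* Classical (Archimedes / Girard): the area of a lune is proportional to its angle. [folklore]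
-/

noncomputable section

namespace Literature.Geometry.DiscreteGeometry

open Real RealInnerProductSpace MeasureTheory Metric Set

/-! ### Part L. Additive monotone functions on an interval are linear -/

section Linear

/-- **Cauchy's functional equation with monotonicity, on an interval.**  If `g` is monotone on
`[0, c]` and additive there (`g (s + t) = g s + g t` for `s, t ≥ 0`, `s + t ≤ c`), then
`g t = (t / c) · g c` on `[0, c]`. [folklore] -/
theorem eq_div_mul_of_additive_of_monotoneOn {g : ℝ → ℝ} {c : ℝ} (hc : 0 < c)
    (hmono : MonotoneOn g (Icc 0 c))
    (hadd : ∀ s t, 0 ≤ s → 0 ≤ t → s + t ≤ c → g (s + t) = g s + g t) {t : ℝ}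
    (ht : t ∈ Icc 0 c) : g t = t / c * g c := by
  have hg0 : g 0 = 0 := by
    have := hadd 0 0 le_rfl le_rfl (by simpa using hc.le)
    simp only [add_zero] at this
    linarith
  have hgc : 0 ≤ g c := by
    rw [← hg0]
    exact hmono ⟨le_rfl, hc.le⟩ ⟨hc.le, le_rfl⟩ hc.le
  -- `g (k c / n) = k g(c / n)` for `k ≤ n`
  have hstep : ∀ n : ℕ, 0 < n → ∀ k : ℕ, k ≤ n → g (k * (c / n)) = k * g (c / n) := by
    intro n hn k
    induction k with
    | zero => intro; simp [hg0]
    | succ k ih =>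
      intro hk
      have hk' : k ≤ n := Nat.le_of_succ_le hk
      have hcn : 0 ≤ c / n := div_nonneg hc.le (Nat.cast_nonneg n)
      have hle : (k : ℝ) * (c / n) + c / n ≤ c := by
        have : ((k : ℝ) + 1) * (c / n) ≤ n * (c / n) := by
          apply mul_le_mul_of_nonneg_right _ hcn
          exact_mod_cast hk
        rw [mul_div_cancel₀ _ (Nat.cast_pos.2 hn).ne'] at this
        linarith
      rw [Nat.cast_succ, add_mul, one_mul, hadd _ _ (mul_nonneg (Nat.cast_nonneg k) hcn) hcn hle,
        ih hk']
      ring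
  have hcn : ∀ n : ℕ, 0 < n → g (c / n) = g c / n := by
    intro n hn
    have h := hstep n hn n le_rfl
    rw [mul_div_cancel₀ _ (Nat.cast_pos.2 hn).ne'] at h
    field_simp
    linarith
  have hfrac : ∀ n : ℕ, 0 < n → ∀ k : ℕ, k ≤ n → g (k * (c / n)) = k / n * g c := by
    intro n hn k hk
    rw [hstep n hn k hk, hcn n hn]
    ring
  -- squeeze
  obtain ⟨ht0, htc⟩ := ht
  have hbound : ∀ n : ℕ, 0 < n → |g t - t / c * g c| ≤ g c / n := by
    intro n hn
    have hn' : (0 : ℝ) < n := Nat.cast_pos.2 hn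
    set k := ⌊t * n / c⌋₊ with hk
    have hk1 : (k : ℝ) ≤ t * n / c := Nat.floor_le (by positivity)
    have hk2 : t * n / c < k + 1 := Nat.lt_floor_add_one _
    have hkn : k ≤ n := by
      have : (k : ℝ) ≤ n := hk1.trans (by rw [div_le_iff₀ hc]; nlinarith)
      exact_mod_cast this
    -- lower bound
    have hlow : (k : ℝ) / n * g c ≤ g t := by
      rw [← hfrac n hn k hkn]
      refine hmono ⟨by positivity, ?_⟩ ⟨ht0, htc⟩ ?_
      · calc (k : ℝ) * (c / n) ≤ n * (c / n) :=
            mul_le_mul_of_nonneg_right (by exact_mod_cast hkn) (div_nonneg hc.le hn'.le)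
          _ = c := mul_div_cancel₀ _ hn'.ne'
      · have := (le_div_iff₀ hc).1 hk1
        calc (k : ℝ) * (c / n) = k * c / n := by ring
          _ ≤ t * n / n := div_le_div_of_nonneg_right this hn'.le
          _ = t := mul_div_cancel_right₀ t hn'.ne'
    -- upper bound
    have hup : g t ≤ ((k : ℝ) + 1) / n * g c := by
      rcases Nat.lt_or_ge k n with hlt | hge
      · have hk1n : k + 1 ≤ n := hlt
        have h := hfrac n hn (k + 1) hk1n
        push_cast at h
        rw [← h]
        refine hmono ⟨ht0, htc⟩ ⟨by positivity, ?_⟩ ?_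
        · calc ((k : ℝ) + 1) * (c / n) ≤ n * (c / n) :=
              mul_le_mul_of_nonneg_right (by exact_mod_cast hk1n) (div_nonneg hc.le hn'.le)
            _ = c := mul_div_cancel₀ _ hn'.ne'
        · have := (div_lt_iff₀ hc).1 hk2
          calc t = t * n / n := (mul_div_cancel_right₀ t hn'.ne').symm
            _ ≤ (k + 1) * c / n := div_le_div_of_nonneg_right this.le hn'.le
            _ = ((k : ℝ) + 1) * (c / n) := by ring
      · have hkn' : k = n := le_antisymm hkn hge
        calc g t ≤ g c := hmono ⟨ht0, htc⟩ ⟨hc.le, le_rfl⟩ htc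
          _ = (n : ℝ) / n * g c := by rw [div_self hn'.ne', one_mul]
          _ ≤ ((k : ℝ) + 1) / n * g c := by
              rw [hkn']
              exact mul_le_mul_of_nonneg_right
                (div_le_div_of_nonneg_right (by linarith) hn'.le) hgc
    have ht1 : (k : ℝ) / n ≤ t / c := by
      rw [div_le_div_iff₀ hn' hc]; nlinarith [(le_div_iff₀ hc).1 hk1]
    have ht2 : t / c ≤ (k + 1) / n := by
      rw [div_le_div_iff₀ hc hn']; nlinarith [(div_lt_iff₀ hc).1 hk2]
    rw [abs_le]
    constructor
    · have : t / c * g c ≤ (k + 1) / n * g c := mul_le_mul_of_nonneg_right ht2 hgc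
      have e : ((k : ℝ) + 1) / n * g c = k / n * g c + g c / n := by ring
      linarith
    · have : (k : ℝ) / n * g c ≤ t / c * g c := mul_le_mul_of_nonneg_right ht1 hgc
      have e : ((k : ℝ) + 1) / n * g c = k / n * g c + g c / n := by ring
      linarith
  -- conclude
  by_contra hne
  have hpos : 0 < |g t - t / c * g c| := abs_pos.2 (sub_ne_zero.2 hne)
  obtain ⟨n, hn⟩ := exists_nat_gt (g c / |g t - t / c * g c|)
  have hn0 : 0 < n := by
    have : (0 : ℝ) < n := lt_of_le_of_lt (by positivity) hn
    exact_mod_cast this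
  have := hbound n hn0
  rw [div_lt_iff₀ hpos] at hn
  have hn' : (0 : ℝ) < n := Nat.cast_pos.2 hn0
  rw [le_div_iff₀ hn'] at this
  linarith

end Linear

/-! ### Part W. Wedges about an axis in a real inner product space -/

section Wedge

variable {E : Type*} [NormedAddCommGroup E] [InnerProductSpace ℝ E]

/-- The linear form `L_φ(x) = −sin φ ⟪e₀, x⟫ + cos φ ⟪e₁, x⟫` — in the coordinates
`(X, Y) = (⟪e₀,x⟫, ⟪e₁,x⟫) = r (cos ψ, sin ψ)` it equals `r sin (ψ − φ)`, so `L_φ ≥ 0` is the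
closed half-space to the left of the half-plane of azimuth `φ` about the axis `{e₀, e₁}ᗮ`.
[folklore] -/
def wedgeFun (e₀ e₁ : E) (φ : ℝ) (x : E) : ℝ :=
  -Real.sin φ * ⟪e₀, x⟫ + Real.cos φ * ⟪e₁, x⟫

/-- **The wedge of azimuths `[φ₁, φ₂]`** about the axis `{e₀, e₁}ᗮ` (for `0 < φ₂ − φ₁ ≤ π`):
`{x | L_{φ₁} x ≥ 0 ∧ L_{φ₂} x ≤ 0}`, the intersection of two closed half-spaces whose dihedral
angle is `φ₂ − φ₁`. [folklore] -/
def wedge (e₀ e₁ : E) (φ₁ φ₂ : ℝ) : Set E :=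
  {x | 0 ≤ wedgeFun e₀ e₁ φ₁ x ∧ wedgeFun e₀ e₁ φ₂ x ≤ 0}

omit [NormedAddCommGroup E] [InnerProductSpace ℝ E] in
/-- The sine identity behind the three-term relation of the forms `L_φ`. [folklore] -/
theorem sin_sub_mul_sin_sub (p q t ψ : ℝ) :
    Real.sin (q - p) * Real.sin (ψ - t) =
      Real.sin (q - t) * Real.sin (ψ - p) + Real.sin (t - p) * Real.sin (ψ - q) := by
  simp only [Real.sin_sub]
  ring

/-- **Three-term relation**: `sin(q − p) L_t = sin(q − t) L_p + sin(t − p) L_q` (any three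
half-planes about a common axis are linearly dependent). [folklore] -/
theorem wedgeFun_three (e₀ e₁ : E) (p q t : ℝ) (x : E) :
    Real.sin (q - p) * wedgeFun e₀ e₁ t x =
      Real.sin (q - t) * wedgeFun e₀ e₁ p x + Real.sin (t - p) * wedgeFun e₀ e₁ q x := by
  simp only [wedgeFun, Real.sin_sub]
  ring

/-- `L_φ` is continuous. [folklore] -/
theorem continuous_wedgeFun (e₀ e₁ : E) (φ : ℝ) : Continuous (wedgeFun e₀ e₁ φ) := by
  unfold wedgeFun
  fun_prop

/-- A wedge is closed … [folklore] -/
theorem isClosed_wedge (e₀ e₁ : E) (φ₁ φ₂ : ℝ) : IsClosed (wedge e₀ e₁ φ₁ φ₂) :=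
  (isClosed_le continuous_const (continuous_wedgeFun e₀ e₁ φ₁)).inter
    (isClosed_le (continuous_wedgeFun e₀ e₁ φ₂) continuous_const)

/-- **Splitting a wedge**: for `a < b < c` with `c − a ≤ π`,
`wedge a c = wedge a b ∪ wedge b c`. [folklore] -/
theorem wedge_eq_union (e₀ e₁ : E) {a b c : ℝ} (hab : a < b) (hbc : b < c) (hca : c - a ≤ π) :
    wedge e₀ e₁ a c = wedge e₀ e₁ a b ∪ wedge e₀ e₁ b c := by
  ext x
  simp only [wedge, mem_setOf_eq, mem_union]
  have hsab : 0 < Real.sin (b - a) := Real.sin_pos_of_pos_of_lt_pi (by linarith) (by linarith)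
  have hsbc : 0 < Real.sin (c - b) := Real.sin_pos_of_pos_of_lt_pi (by linarith) (by linarith)
  have hsca : 0 ≤ Real.sin (c - a) := Real.sin_nonneg_of_nonneg_of_le_pi (by linarith) hca
  constructor
  · rintro ⟨ha, hc⟩
    rcases le_total (wedgeFun e₀ e₁ b x) 0 with hb | hb
    · exact Or.inl ⟨ha, hb⟩
    · exact Or.inr ⟨hb, hc⟩
  · rintro (⟨ha, hb⟩ | ⟨hb, hc⟩)
    · refine ⟨ha, ?_⟩
      -- sin(b−a) L_c = sin(b−c) L_a + sin(c−a) L_b ≤ 0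
      have h3 := wedgeFun_three e₀ e₁ a b c x
      have h1 : Real.sin (b - c) * wedgeFun e₀ e₁ a x ≤ 0 :=
        mul_nonpos_of_nonpos_of_nonneg (by rw [← neg_sub, Real.sin_neg]; linarith) ha
      have h2 : Real.sin (c - a) * wedgeFun e₀ e₁ b x ≤ 0 := mul_nonpos_of_nonneg_of_nonpos hsca hb
      nlinarith
    · refine ⟨?_, hc⟩
      -- sin(c−b) L_a = sin(c−a) L_b + sin(a−b) L_c ≥ 0
      have h3 := wedgeFun_three e₀ e₁ b c a x
      have h1 : 0 ≤ Real.sin (c - a) * wedgeFun e₀ e₁ b x := mul_nonneg hsca hb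
      have h2 : 0 ≤ Real.sin (a - b) * wedgeFun e₀ e₁ c x :=
        mul_nonneg_of_nonpos_of_nonpos (by rw [← neg_sub, Real.sin_neg]; linarith) hc
      nlinarith

/-- … the two pieces overlap only on the half-plane… in fact on the plane `L_b = 0`.
[folklore] -/
theorem wedge_inter_wedge_subset (e₀ e₁ : E) (a b c : ℝ) :
    wedge e₀ e₁ a b ∩ wedge e₀ e₁ b c ⊆ {x | wedgeFun e₀ e₁ b x = 0} := by
  rintro x ⟨⟨-, hb⟩, ⟨hb', -⟩⟩
  exact le_antisymm hb hb'

/-- A degenerate wedge `wedge a a` is contained in the plane `L_a = 0`. [folklore] -/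
theorem wedge_self_subset (e₀ e₁ : E) (a : ℝ) :
    wedge e₀ e₁ a a ⊆ {x | wedgeFun e₀ e₁ a x = 0} := by
  rintro x ⟨ha, ha'⟩
  exact le_antisymm ha' ha

/-- `wedge 0 π` is the closed half-space `⟪e₁, x⟫ ≥ 0`. [folklore] -/
theorem wedge_zero_pi (e₀ e₁ : E) : wedge e₀ e₁ 0 π = {x | 0 ≤ ⟪e₁, x⟫} := by
  ext x
  simp [wedge, wedgeFun]

/-- The plane `L_φ = 0` is the kernel of pairing with the unit vector
`n_φ = −sin φ • e₀ + cos φ • e₁`. [folklore] -/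
theorem wedgeFun_eq_inner (e₀ e₁ : E) (φ : ℝ) (x : E) :
    wedgeFun e₀ e₁ φ x = ⟪-Real.sin φ • e₀ + Real.cos φ • e₁, x⟫ := by
  simp only [wedgeFun, inner_add_left, real_inner_smul_left, neg_mul, neg_smul, inner_neg_left]

/-- For an orthonormal pair, `n_φ` is a unit vector (in particular nonzero). [folklore] -/
theorem norm_wedgeNormal {e₀ e₁ : E} (h : Orthonormal ℝ ![e₀, e₁]) (φ : ℝ) :
    ‖-Real.sin φ • e₀ + Real.cos φ • e₁‖ = 1 := by
  have h00 : ⟪e₀, e₀⟫ = 1 := by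
    have := h.1 0; simp at this; rw [real_inner_self_eq_norm_sq, this]; norm_num
  have h11 : ⟪e₁, e₁⟫ = 1 := by
    have := h.1 1; simp at this; rw [real_inner_self_eq_norm_sq, this]; norm_num
  have h01 : ⟪e₀, e₁⟫ = 0 := by
    have := h.2 (show (0 : Fin 2) ≠ 1 by decide); simpa using this
  have hsq : ‖-Real.sin φ • e₀ + Real.cos φ • e₁‖ ^ 2 = 1 := by
    rw [← real_inner_self_eq_norm_sq]
    simp only [inner_add_left, inner_add_right, real_inner_smul_left, real_inner_smul_right, h00,
      h11, h01, real_inner_comm e₀ e₁]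
    nlinarith [Real.sin_sq_add_cos_sq φ]
  nlinarith [norm_nonneg (-Real.sin φ • e₀ + Real.cos φ • e₁)]

/-! #### The rotation about the axis -/

/-- **Rotation by `α` in the plane of the orthonormal pair `e₀, e₁`**, the identity on
`{e₀, e₁}ᗮ`: `x ↦ x + (cos α − 1)(X e₀ + Y e₁) + sin α (X e₁ − Y e₀)` with `X = ⟪e₀, x⟫`,
`Y = ⟪e₁, x⟫`; as a linear map. [folklore] -/
def planeRotLin (e₀ e₁ : E) (α : ℝ) : E →ₗ[ℝ] E where
  toFun x := x + (Real.cos α - 1) • (⟪e₀, x⟫ • e₀ + ⟪e₁, x⟫ • e₁)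
    + Real.sin α • (⟪e₀, x⟫ • e₁ - ⟪e₁, x⟫ • e₀)
  map_add' x y := by
    simp only [inner_add_right, add_smul]
    module
  map_smul' c x := by
    simp only [inner_smul_right, RingHom.id_apply, smul_add, smul_sub, smul_smul]
    module

/-- Unfolding `planeRotLin`. [folklore] -/
theorem planeRotLin_apply (e₀ e₁ : E) (α : ℝ) (x : E) :
    planeRotLin e₀ e₁ α x = x + (Real.cos α - 1) • (⟪e₀, x⟫ • e₀ + ⟪e₁, x⟫ • e₁)
      + Real.sin α • (⟪e₀, x⟫ • e₁ - ⟪e₁, x⟫ • e₀) := rfl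

variable {e₀ e₁ : E}

/-- Orthonormality unpacked. [folklore] -/
theorem inner_pair_of_orthonormal (h : Orthonormal ℝ ![e₀, e₁]) :
    ⟪e₀, e₀⟫ = 1 ∧ ⟪e₁, e₁⟫ = 1 ∧ ⟪e₀, e₁⟫ = 0 ∧ ⟪e₁, e₀⟫ = 0 := by
  have h00 : ⟪e₀, e₀⟫ = 1 := by
    have := h.1 0; simp at this; rw [real_inner_self_eq_norm_sq, this]; norm_num
  have h11 : ⟪e₁, e₁⟫ = 1 := by
    have := h.1 1; simp at this; rw [real_inner_self_eq_norm_sq, this]; norm_num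
  have h01 : ⟪e₀, e₁⟫ = 0 := by
    have := h.2 (show (0 : Fin 2) ≠ 1 by decide); simpa using this
  exact ⟨h00, h11, h01, by rw [real_inner_comm]; exact h01⟩

/-- The new coordinates: `⟪e₀, R x⟫ = cos α X − sin α Y`. [folklore] -/
theorem inner_planeRotLin_left (h : Orthonormal ℝ ![e₀, e₁]) (α : ℝ) (x : E) :
    ⟪e₀, planeRotLin e₀ e₁ α x⟫ = Real.cos α * ⟪e₀, x⟫ - Real.sin α * ⟪e₁, x⟫ := by
  obtain ⟨h00, h11, h01, h10⟩ := inner_pair_of_orthonormal h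
  simp only [planeRotLin_apply, inner_add_right, inner_sub_right, real_inner_smul_right, h00, h01]
  ring

/-- The new coordinates: `⟪e₁, R x⟫ = sin α X + cos α Y`. [folklore] -/
theorem inner_planeRotLin_right (h : Orthonormal ℝ ![e₀, e₁]) (α : ℝ) (x : E) :
    ⟪e₁, planeRotLin e₀ e₁ α x⟫ = Real.sin α * ⟪e₀, x⟫ + Real.cos α * ⟪e₁, x⟫ := by
  obtain ⟨h00, h11, h01, h10⟩ := inner_pair_of_orthonormal h
  simp only [planeRotLin_apply, inner_add_right, inner_sub_right, real_inner_smul_right, h11, h10]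
  ring

/-- The rotation preserves norms. [folklore] -/
theorem norm_planeRotLin (h : Orthonormal ℝ ![e₀, e₁]) (α : ℝ) (x : E) :
    ‖planeRotLin e₀ e₁ α x‖ = ‖x‖ := by
  obtain ⟨h00, h11, h01, h10⟩ := inner_pair_of_orthonormal h
  have hsq : ‖planeRotLin e₀ e₁ α x‖ ^ 2 = ‖x‖ ^ 2 := by
    rw [← real_inner_self_eq_norm_sq, ← real_inner_self_eq_norm_sq, planeRotLin_apply]
    simp only [inner_add_left, inner_add_right, inner_sub_left, inner_sub_right,
      real_inner_smul_left, real_inner_smul_right, h00, h11, h01, h10, real_inner_comm e₀ x,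
      real_inner_comm e₁ x]
    nlinarith [Real.sin_sq_add_cos_sq α]
  nlinarith [norm_nonneg (planeRotLin e₀ e₁ α x), norm_nonneg x]

/-- The rotation preserves inner products. [folklore] -/
theorem inner_planeRotLin (h : Orthonormal ℝ ![e₀, e₁]) (α : ℝ) (x y : E) :
    ⟪planeRotLin e₀ e₁ α x, planeRotLin e₀ e₁ α y⟫ = ⟪x, y⟫ := by
  rw [real_inner_eq_norm_add_mul_self_sub_norm_mul_self_sub_norm_mul_self_div_two,
    real_inner_eq_norm_add_mul_self_sub_norm_mul_self_sub_norm_mul_self_div_two x y,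
    ← map_add, norm_planeRotLin h, norm_planeRotLin h, norm_planeRotLin h]

/-- **The rotation as a linear isometry equivalence** (finite dimension). [folklore] -/
def planeRot [FiniteDimensional ℝ E] (h : Orthonormal ℝ ![e₀, e₁]) (α : ℝ) : E ≃ₗᵢ[ℝ] E :=
  ((planeRotLin e₀ e₁ α).isometryOfInner (inner_planeRotLin h α)).toLinearIsometryEquiv rfl

/-- Unfolding `planeRot`. [folklore] -/
theorem planeRot_apply [FiniteDimensional ℝ E] (h : Orthonormal ℝ ![e₀, e₁]) (α : ℝ) (x : E) :
    planeRot h α x = planeRotLin e₀ e₁ α x := rfl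

/-- **The rotation turns the half-planes**: `L_φ (R_α x) = L_{φ−α} x`. [folklore] -/
theorem wedgeFun_planeRotLin (h : Orthonormal ℝ ![e₀, e₁]) (α φ : ℝ) (x : E) :
    wedgeFun e₀ e₁ φ (planeRotLin e₀ e₁ α x) = wedgeFun e₀ e₁ (φ - α) x := by
  simp only [wedgeFun, inner_planeRotLin_left h, inner_planeRotLin_right h, Real.sin_sub,
    Real.cos_sub]
  ring

/-- Hence `R_α ⁻¹' wedge (a + α) (b + α) = wedge a b`. [folklore] -/
theorem preimage_planeRot_wedge [FiniteDimensional ℝ E] (h : Orthonormal ℝ ![e₀, e₁])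
    (α a b : ℝ) : planeRot h α ⁻¹' wedge e₀ e₁ (a + α) (b + α) = wedge e₀ e₁ a b := by
  ext x
  simp only [mem_preimage, wedge, mem_setOf_eq, planeRot_apply, wedgeFun_planeRotLin h,
    add_sub_cancel_right]

/-- A linear isometry equivalence pulls the unit ball back to itself. [folklore] -/
theorem preimage_ball_zero_one (R : E ≃ₗᵢ[ℝ] E) : R ⁻¹' ball (0 : E) 1 = ball 0 1 := by
  ext x
  simp [mem_ball, dist_zero_right]

end Wedge

/-! ### Part M. Volumes: null planes, half-spaces, and the wedge of angle `θ` -/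

section Volume

variable {E : Type*} [NormedAddCommGroup E] [InnerProductSpace ℝ E] [FiniteDimensional ℝ E]
  [MeasurableSpace E] [BorelSpace E]

/-- A hyperplane through `0` is a null set. [folklore] -/
theorem volume_inner_eq_zero {n : E} (hn : n ≠ 0) : volume {x : E | ⟪n, x⟫ = 0} = 0 := by
  have hset : {x : E | ⟪n, x⟫ = 0} = ((ℝ ∙ n)ᗮ : Submodule ℝ E) := by
    ext x
    simp [Submodule.mem_orthogonal_singleton_iff_inner_right]
  rw [hset]
  apply Measure.addHaar_submodule
  intro htop
  have hmem : n ∈ (ℝ ∙ n)ᗮ := by rw [htop]; trivial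
  rw [Submodule.mem_orthogonal_singleton_iff_inner_right] at hmem
  exact hn (inner_self_eq_zero.1 hmem)

/-- The plane `L_φ = 0` of an orthonormal pair is a null set. [folklore] -/
theorem volume_wedgeFun_eq_zero {e₀ e₁ : E} (h : Orthonormal ℝ ![e₀, e₁]) (φ : ℝ) :
    volume {x : E | wedgeFun e₀ e₁ φ x = 0} = 0 := by
  have hn : -Real.sin φ • e₀ + Real.cos φ • e₁ ≠ 0 := by
    intro h0
    have := norm_wedgeNormal h φ
    rw [h0, norm_zero] at this
    exact zero_ne_one this
  have hset : {x : E | wedgeFun e₀ e₁ φ x = 0} =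
      {x : E | ⟪-Real.sin φ • e₀ + Real.cos φ • e₁, x⟫ = 0} := by
    ext x
    rw [mem_setOf_eq, mem_setOf_eq, wedgeFun_eq_inner]
  rw [hset]
  exact volume_inner_eq_zero hn

/-- **A closed half-space through the centre halves the ball.** [folklore] -/
theorem volume_halfspace_inter_ball {n : E} (hn : n ≠ 0) :
    volume ({x : E | 0 ≤ ⟪n, x⟫} ∩ ball 0 1) = volume (ball (0 : E) 1) / 2 := by
  set Hp : Set E := {x | 0 ≤ ⟪n, x⟫} with hHp
  set Hm : Set E := {x | ⟪n, x⟫ ≤ 0} with hHm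
  have hmeasp : MeasurableSet Hp := (isClosed_le continuous_const (by fun_prop)).measurableSet
  have hmeasm : MeasurableSet Hm := (isClosed_le (by fun_prop) continuous_const).measurableSet
  -- symmetry
  have hsymm : volume (Hm ∩ ball 0 1) = volume (Hp ∩ ball 0 1) := by
    have hpre : (LinearIsometryEquiv.neg ℝ : E ≃ₗᵢ[ℝ] E) ⁻¹' (Hp ∩ ball 0 1) = Hm ∩ ball 0 1 := by
      ext x
      simp [hHp, hHm, inner_neg_right, mem_ball, dist_zero_right]
    rw [← hpre]
    exact (LinearIsometryEquiv.neg ℝ (E := E)).measurePreserving.measure_preimage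
      (hmeasp.inter measurableSet_ball).nullMeasurableSet
  -- union and intersection
  have hunion : Hp ∩ ball 0 1 ∪ Hm ∩ ball 0 1 = ball 0 1 := by
    rw [← union_inter_distrib_right]
    refine inter_eq_self_of_subset_right fun x _ => ?_
    simp only [hHp, hHm, mem_union, mem_setOf_eq]
    exact le_total _ _
  have hinter : volume (Hp ∩ ball 0 1 ∩ (Hm ∩ ball 0 1)) = 0 := by
    refine measure_mono_null (fun x hx => ?_) (volume_inner_eq_zero hn)
    simp only [hHp, hHm, mem_inter_iff, mem_setOf_eq] at hx
    exact le_antisymm hx.2.1 hx.1.1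
  have hadd := measure_union_add_inter (μ := volume) (Hp ∩ ball 0 1)
    (t := Hm ∩ ball (0 : E) 1) (hmeasm.inter measurableSet_ball)
  rw [hunion, hinter, add_zero, hsymm] at hadd
  -- `vol B = v + v`
  rw [hadd, ENNReal.add_div, ENNReal.add_halves]

omit [FiniteDimensional ℝ E] [MeasurableSpace E] [BorelSpace E] in
/-- Wedges are measurable. [folklore] -/
theorem measurableSet_wedge [MeasurableSpace E] [OpensMeasurableSpace E] (e₀ e₁ : E) (a b : ℝ) :
    MeasurableSet (wedge e₀ e₁ a b) :=
  (isClosed_wedge e₀ e₁ a b).measurableSet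

/-- **Rotation invariance**: `vol (wedge a b ∩ B) = vol (wedge (a + α) (b + α) ∩ B)`.
[folklore] -/
theorem volume_wedge_inter_ball_add {e₀ e₁ : E} (h : Orthonormal ℝ ![e₀, e₁]) (α a b : ℝ) :
    volume (wedge e₀ e₁ a b ∩ ball 0 1) = volume (wedge e₀ e₁ (a + α) (b + α) ∩ ball 0 1) := by
  have hpre : planeRot h α ⁻¹' (wedge e₀ e₁ (a + α) (b + α) ∩ ball 0 1) =
      wedge e₀ e₁ a b ∩ ball 0 1 := by
    rw [preimage_inter, preimage_planeRot_wedge, preimage_ball_zero_one]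
  rw [← hpre]
  exact (planeRot h α).measurePreserving.measure_preimage
    ((measurableSet_wedge e₀ e₁ (a + α) (b + α)).inter
      (measurableSet_ball (x := (0 : E)) (ε := 1))).nullMeasurableSet

/-- The ball has finite volume. [folklore] -/
theorem volume_ball_lt_top' : volume (ball (0 : E) 1) < ⊤ := measure_ball_lt_top

/-- **The wedge-volume function** `f θ = vol (wedge 0 θ ∩ B)` (real-valued). [folklore] -/
def wedgeVol (e₀ e₁ : E) (θ : ℝ) : ℝ := (volume (wedge e₀ e₁ 0 θ ∩ ball (0 : E) 1)).toReal

/-- `f 0 = 0` (a degenerate wedge is a null plane). [folklore] -/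
theorem wedgeVol_zero {e₀ e₁ : E} (h : Orthonormal ℝ ![e₀, e₁]) : wedgeVol e₀ e₁ 0 = 0 := by
  rw [wedgeVol, measure_mono_null ((inter_subset_left).trans (wedge_self_subset e₀ e₁ 0))
    (volume_wedgeFun_eq_zero h 0), ENNReal.toReal_zero]

/-- **Additivity**: `f (s + t) = f s + f t` for `s, t ≥ 0`, `s + t ≤ π` — split the wedge at
azimuth `s` (the overlap is a null plane) and rotate the second piece back by `s`. [folklore] -/
theorem wedgeVol_add {e₀ e₁ : E} (h : Orthonormal ℝ ![e₀, e₁]) {s t : ℝ} (hs : 0 ≤ s) (ht : 0 ≤ t)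
    (hst : s + t ≤ π) : wedgeVol e₀ e₁ (s + t) = wedgeVol e₀ e₁ s + wedgeVol e₀ e₁ t := by
  rcases hs.eq_or_lt with rfl | hs'
  · rw [zero_add, wedgeVol_zero h, zero_add]
  rcases ht.eq_or_lt with rfl | ht'
  · rw [add_zero, wedgeVol_zero h, add_zero]
  have hsplit := wedge_eq_union e₀ e₁ hs' (by linarith : s < s + t) (by linarith : s + t - 0 ≤ π)
  have hnull : volume (wedge e₀ e₁ 0 s ∩ ball 0 1 ∩ (wedge e₀ e₁ s (s + t) ∩ ball 0 1)) = 0 := by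
    refine measure_mono_null (fun x hx => ?_) (volume_wedgeFun_eq_zero h s)
    exact wedge_inter_wedge_subset e₀ e₁ 0 s (s + t) ⟨hx.1.1, hx.2.1⟩
  have hadd := measure_union_add_inter (μ := volume) (wedge e₀ e₁ 0 s ∩ ball 0 1)
    (t := wedge e₀ e₁ s (s + t) ∩ ball (0 : E) 1)
    ((measurableSet_wedge e₀ e₁ s (s + t)).inter measurableSet_ball)
  rw [hnull, add_zero, ← union_inter_distrib_right, ← hsplit] at hadd
  have hrot : volume (wedge e₀ e₁ s (s + t) ∩ ball 0 1) = volume (wedge e₀ e₁ 0 t ∩ ball 0 1) := by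
    rw [volume_wedge_inter_ball_add h s 0 t, zero_add, add_comm t s]
  rw [wedgeVol, wedgeVol, wedgeVol, hadd, hrot, ENNReal.toReal_add]
  · exact (measure_lt_top_of_subset inter_subset_right volume_ball_lt_top'.ne).ne
  · exact (measure_lt_top_of_subset inter_subset_right volume_ball_lt_top'.ne).ne

/-- **Monotonicity** of `f` on `[0, π]`. [folklore] -/
theorem wedgeVol_monotoneOn {e₀ e₁ : E} (h : Orthonormal ℝ ![e₀, e₁]) :
    MonotoneOn (wedgeVol e₀ e₁) (Icc 0 π) := by
  intro s hs t ht hst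
  have := wedgeVol_add h hs.1 (sub_nonneg.2 hst) (by linarith [ht.2])
  rw [add_sub_cancel] at this
  rw [this]
  exact le_add_of_nonneg_right ENNReal.toReal_nonneg

/-- **`f π = vol B / 2`** (the wedge of angle `π` is a half-space). [folklore] -/
theorem wedgeVol_pi {e₀ e₁ : E} (h : Orthonormal ℝ ![e₀, e₁]) :
    wedgeVol e₀ e₁ π = (volume (ball (0 : E) 1)).toReal / 2 := by
  have he₁ : e₁ ≠ 0 := by
    intro h0
    have := h.1 1
    simp [h0] at this
  rw [wedgeVol, wedge_zero_pi, volume_halfspace_inter_ball he₁, ENNReal.toReal_div]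
  norm_num

/-- **The volume of a wedge of dihedral angle `θ ∈ [0, π]` is the fraction `θ / 2π` of the
ball** (real form). [folklore] -/
theorem wedgeVol_eq {e₀ e₁ : E} (h : Orthonormal ℝ ![e₀, e₁]) {θ : ℝ} (hθ : θ ∈ Icc 0 π) :
    wedgeVol e₀ e₁ θ = θ / (2 * π) * (volume (ball (0 : E) 1)).toReal := by
  rw [eq_div_mul_of_additive_of_monotoneOn Real.pi_pos (wedgeVol_monotoneOn h)
    (fun s t hs ht hst => wedgeVol_add h hs ht hst) hθ, wedgeVol_pi h]
  ring

/-- **The volume of a wedge of dihedral angle `θ ∈ [0, π]`**, `ℝ≥0∞` form: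
`vol (wedge 0 θ ∩ B) = (θ / 2π) · vol B`. [folklore] -/
theorem volume_wedge_inter_ball {e₀ e₁ : E} (h : Orthonormal ℝ ![e₀, e₁]) {θ : ℝ}
    (hθ : θ ∈ Icc 0 π) :
    volume (wedge e₀ e₁ 0 θ ∩ ball (0 : E) 1) =
      ENNReal.ofReal (θ / (2 * π)) * volume (ball (0 : E) 1) := by
  have hfin : volume (wedge e₀ e₁ 0 θ ∩ ball (0 : E) 1) ≠ ⊤ :=
    (measure_lt_top_of_subset inter_subset_right volume_ball_lt_top'.ne).ne
  have h1 := wedgeVol_eq h hθ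
  rw [wedgeVol] at h1
  rw [← ENNReal.ofReal_toReal hfin, h1, ENNReal.ofReal_mul (by
    exact div_nonneg hθ.1 (by positivity)), ENNReal.ofReal_toReal volume_ball_lt_top'.ne]

end Volume

/-! ### Part D. The intersection of two half-spaces through the centre -/

section TwoHalfspaces

variable {E : Type*} [NormedAddCommGroup E] [InnerProductSpace ℝ E] [FiniteDimensional ℝ E]
  [MeasurableSpace E] [BorelSpace E]

open InnerProductGeometry

/-- **The volume of the intersection of two closed half-spaces through the centre with the
unit ball is the fraction `(π − ∠(n₁, n₂)) / 2π` of the ball**, `n₁, n₂` the (linearly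
independent) inward normals: the dihedral angle of the wedge `{⟪n₁, ·⟫ ≥ 0} ∩ {⟪n₂, ·⟫ ≥ 0}` is
`π − ∠(n₁, n₂)`.  (Any finite dimension `≥ 2`; in `ℝ³` this is "the volume of a spherical
wedge / the area of a lune is proportional to its angle".) [folklore] -/
theorem volume_halfspace_inter_halfspace_inter_ball {n₁ n₂ : E}
    (hli : LinearIndependent ℝ ![n₁, n₂]) :
    volume ({x : E | 0 ≤ ⟪n₁, x⟫} ∩ {x | 0 ≤ ⟪n₂, x⟫} ∩ ball 0 1) =
      ENNReal.ofReal ((π - angle n₁ n₂) / (2 * π)) * volume (ball (0 : E) 1) := by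
  have h₁ : n₁ ≠ 0 := hli.ne_zero 0
  have h₂ : n₂ ≠ 0 := hli.ne_zero 1
  have hn₁ : 0 < ‖n₁‖ := norm_pos_iff.2 h₁
  have hn₂ : 0 < ‖n₂‖ := norm_pos_iff.2 h₂
  -- the frame: `e₁ = n₁/‖n₁‖`, `e₀ = w/‖w‖` with `w = n₂ − ⟪e₁, n₂⟫ e₁`
  obtain ⟨e₁, he₁⟩ : ∃ e₁ : E, e₁ = ‖n₁‖⁻¹ • n₁ := ⟨_, rfl⟩
  have he₁n : ‖e₁‖ = 1 := by
    rw [he₁, norm_smul, norm_inv, norm_norm, inv_mul_cancel₀ hn₁.ne']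
  have he₁e₁ : ⟪e₁, e₁⟫ = 1 := by rw [real_inner_self_eq_norm_sq, he₁n]; norm_num
  obtain ⟨w, hw⟩ : ∃ w : E, w = n₂ - ⟪e₁, n₂⟫ • e₁ := ⟨_, rfl⟩
  have hwe₁ : ⟪w, e₁⟫ = 0 := by
    rw [hw, inner_sub_left, real_inner_smul_left, he₁e₁, real_inner_comm]; ring
  have hw0 : w ≠ 0 := by
    intro hw0
    have : (⟪e₁, n₂⟫ * ‖n₁‖⁻¹) • n₁ = n₂ := by
      rw [mul_smul, ← he₁]
      exact (sub_eq_zero.1 (hw.symm.trans hw0)).symm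
    exact (LinearIndependent.pair_iff' h₁).1 hli _ this
  have hwn : 0 < ‖w‖ := norm_pos_iff.2 hw0
  obtain ⟨e₀, he₀⟩ : ∃ e₀ : E, e₀ = ‖w‖⁻¹ • w := ⟨_, rfl⟩
  have he₀n : ‖e₀‖ = 1 := by
    rw [he₀, norm_smul, norm_inv, norm_norm, inv_mul_cancel₀ hwn.ne']
  have he₀e₀ : ⟪e₀, e₀⟫ = 1 := by rw [real_inner_self_eq_norm_sq, he₀n]; norm_num
  have he₀e₁ : ⟪e₀, e₁⟫ = 0 := by
    rw [he₀, real_inner_smul_left, hwe₁, mul_zero]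
  have hon : Orthonormal ℝ ![e₀, e₁] := by
    classical
    rw [orthonormal_iff_ite]
    intro i j
    fin_cases i <;> fin_cases j
    · simpa using he₀e₀
    · simpa using he₀e₁
    · simpa [real_inner_comm] using he₀e₁
    · simpa using he₁e₁
  -- `n₂` in the frame
  have hn₂eq : n₂ = ‖w‖ • e₀ + ⟪e₁, n₂⟫ • e₁ := by
    rw [he₀, smul_smul, mul_inv_cancel₀ hwn.ne', one_smul, hw, sub_add_cancel]
  have hn₂x : ∀ x, ⟪n₂, x⟫ = ‖w‖ * ⟪e₀, x⟫ + ⟪e₁, n₂⟫ * ⟪e₁, x⟫ := fun x => by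
    conv_lhs => rw [hn₂eq]
    rw [inner_add_left, real_inner_smul_left, real_inner_smul_left]
  have hpyth : ‖n₂‖ ^ 2 = ‖w‖ ^ 2 + ⟪e₁, n₂⟫ ^ 2 := by
    have h := hn₂x n₂
    have h0 : ⟪e₀, n₂⟫ = ‖w‖ := by
      rw [real_inner_comm, hn₂x e₀, he₀e₀, real_inner_comm e₀ e₁, he₀e₁]; ring
    rw [real_inner_self_eq_norm_sq, h0] at h
    nlinarith [h]
  -- the angle
  obtain ⟨u, hu⟩ : ∃ u : ℝ, u = ⟪e₁, n₂⟫ / ‖n₂‖ := ⟨_, rfl⟩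
  have hu1 : -1 ≤ u ∧ u ≤ 1 := by
    have := abs_real_inner_div_norm_mul_norm_le_one e₁ n₂
    rw [he₁n, one_mul, abs_le, ← hu] at this
    exact this
  obtain ⟨θ, hθ⟩ : ∃ θ : ℝ, θ = Real.arccos (-u) := ⟨_, rfl⟩
  have hθeq : θ = π - angle n₁ n₂ := by
    rw [hθ, Real.arccos_neg, angle, hu, he₁, real_inner_smul_left]
    congr 2
    field_simp
  have hcosθ : Real.cos θ = -u := by
    rw [hθ, Real.cos_arccos (by linarith [hu1.2]) (by linarith [hu1.1])]
  have hsinθ : Real.sin θ = ‖w‖ / ‖n₂‖ := by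
    rw [hθ, Real.sin_arccos, neg_sq]
    have h1 : 1 - u ^ 2 = (‖w‖ / ‖n₂‖) ^ 2 := by
      rw [hu, div_pow, div_pow]
      field_simp
      linarith [hpyth]
    rw [h1, Real.sqrt_sq (div_nonneg hwn.le hn₂.le)]
  have hθmem : θ ∈ Icc 0 π := ⟨hθ ▸ Real.arccos_nonneg _, hθ ▸ Real.arccos_le_pi _⟩
  -- the two half-spaces in the frame
  have hset : {x : E | 0 ≤ ⟪n₁, x⟫} ∩ {x | 0 ≤ ⟪n₂, x⟫} = wedge e₀ e₁ 0 θ := by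
    ext x
    simp only [mem_inter_iff, mem_setOf_eq, wedge, wedgeFun, Real.sin_zero, Real.cos_zero,
      neg_zero, zero_mul, zero_add, one_mul, hcosθ, hsinθ]
    have hx1 : ⟪e₁, x⟫ = ‖n₁‖⁻¹ * ⟪n₁, x⟫ := by rw [he₁, real_inner_smul_left]
    have hx2 : -(‖w‖ / ‖n₂‖) * ⟪e₀, x⟫ + -u * ⟪e₁, x⟫ = -(‖n₂‖⁻¹ * ⟪n₂, x⟫) := by
      rw [hu, hn₂x x]
      field_simp
      ring
    rw [hx2, hx1]
    constructor
    · rintro ⟨h1, h2⟩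
      exact ⟨mul_nonneg (inv_nonneg.2 hn₁.le) h1,
        by have := mul_nonneg (inv_nonneg.2 hn₂.le) h2; linarith⟩
    · rintro ⟨h1, h2⟩
      refine ⟨?_, ?_⟩
      · have := mul_nonneg hn₁.le h1
        rwa [← mul_assoc, mul_inv_cancel₀ hn₁.ne', one_mul] at this
      · have h2' : 0 ≤ ‖n₂‖⁻¹ * ⟪n₂, x⟫ := by linarith
        have := mul_nonneg hn₂.le h2'
        rwa [← mul_assoc, mul_inv_cancel₀ hn₂.ne', one_mul] at this
  rw [hset, volume_wedge_inter_ball hon hθmem, hθeq]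

end TwoHalfspaces

/-! ### Part E. In the vocabulary of `SolidAngleFraction.lean`: ball fractions -/

section BallFraction

variable {E : Type*} [NormedAddCommGroup E] [InnerProductSpace ℝ E] [FiniteDimensional ℝ E]
  [MeasurableSpace E] [BorelSpace E]

open InnerProductGeometry

/-- The unit ball has positive finite volume (a nontrivial space is needed for positivity only
through `IsOpenPosMeasure`, which holds for every additive Haar measure). [folklore] -/
theorem volume_ball_toReal_pos [Nontrivial E] : 0 < (volume (ball (0 : E) 1)).toReal :=
  ENNReal.toReal_pos (measure_ball_pos volume (0 : E) one_pos).ne' measure_ball_lt_top.ne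

/-- **The ball fraction of the intersection of two closed half-spaces through the centre is
`(π − ∠(n₁, n₂)) / 2π`** (centre `0`). [folklore] -/
theorem ballFraction_halfspace_inter_halfspace [Nontrivial E] {n₁ n₂ : E}
    (hli : LinearIndependent ℝ ![n₁, n₂]) :
    ballFraction (0 : E) ({x : E | 0 ≤ ⟪n₁, x⟫} ∩ {x | 0 ≤ ⟪n₂, x⟫}) =
      (π - angle n₁ n₂) / (2 * π) := by
  have hnn : 0 ≤ (π - angle n₁ n₂) / (2 * π) :=
    div_nonneg (sub_nonneg.2 (angle_le_pi _ _)) (by positivity)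
  rw [ballFraction, inter_comm, volume_halfspace_inter_halfspace_inter_ball hli,
    ENNReal.toReal_mul, ENNReal.toReal_ofReal hnn, mul_div_assoc,
    div_self volume_ball_toReal_pos.ne', mul_one]

/-- **The same about any apex `v`** (translation invariance of the volume): the fraction of the
unit ball at `v` inside `{x | ⟪n₁, x − v⟫ ≥ 0} ∩ {x | ⟪n₂, x − v⟫ ≥ 0}` is
`(π − ∠(n₁, n₂)) / 2π`. [folklore] -/
theorem ballFraction_halfspace_inter_halfspace_apex [Nontrivial E] (v : E) {n₁ n₂ : E}
    (hli : LinearIndependent ℝ ![n₁, n₂]) :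
    ballFraction v ({x : E | 0 ≤ ⟪n₁, x - v⟫} ∩ {x | 0 ≤ ⟪n₂, x - v⟫}) =
      (π - angle n₁ n₂) / (2 * π) := by
  rw [← ballFraction_halfspace_inter_halfspace hli, ballFraction, ballFraction]
  have hball : ball v 1 = (fun x => x + -v) ⁻¹' ball (0 : E) 1 := by
    ext x; simp [mem_ball, dist_eq_norm, ← sub_eq_add_neg]
  have hset : ball v 1 ∩ ({x : E | 0 ≤ ⟪n₁, x - v⟫} ∩ {x | 0 ≤ ⟪n₂, x - v⟫}) =
      (fun x => x + -v) ⁻¹' (ball (0 : E) 1 ∩ ({x : E | 0 ≤ ⟪n₁, x⟫} ∩ {x | 0 ≤ ⟪n₂, x⟫})) := by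
    rw [hball]; ext x; simp [sub_eq_add_neg]
  rw [hset, hball, measure_preimage_add_right, measure_preimage_add_right]

end BallFraction

end Literature.Geometry.DiscreteGeometry
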